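import Literature.Analysis.Complex.ObreschkoffTheorem
import Mathlib.Analysis.Normed.Module.MultipliableUniformlyOn
import Mathlib.Analysis.Calculus.Deriv.Star
import Mathlib.Algebra.Polynomial.Lifts
import HarnessLib

/-!
# Jensen polynomials of real entire functions of order `< 1` with zeros in a sector (proved)

Trunk `Literature/Analysis/Complex`, grouping namespace `Literature.Analysis.Complex.Obreschkoff`
(continuation of `ObreschkoffTheorem.lean`).

**Theorem** (`splits_jensenPoly_taylor_of_zeros_mem_sector`; Kim–Lee 2021, Remark after Thm. 3,
restricted to order `< 1`). Let `F` be entire with `‖F z‖ ≤ C exp(‖z‖^ρ)` for some `ρ < 1`, real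
(`F(z̄) = conj F(z)`), with `F(0) ≠ 0`, and suppose every zero of `F` lies in the double sector
`S(δ) = {|Im z| ≤ δ |z|}`. Then for `d δ² ≤ 1` the Jensen polynomial `J^{d,0}` of the Taylor sequence
`(F⁽ᵏ⁾(0))_k` of `F` — i.e. `J(F; d) = Σ_k (d choose k) F⁽ᵏ⁾(0) X^k` — has only real zeros.
Kim–Lee (for order `< 2`, via the genus-one Hadamard product): "Let `P_1, P_2, …` be real polynomials
such that `Z(P_k) ⊂ Z(f) ∪ ℝ` for all `k`, and `P_k → f` uniformly on compact sets … the corollary to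
Theorem 3 implies that `J(P_k; d)` is hyperbolic for every `k`. Therefore `J(f; d)` is hyperbolic."
This is the analytic half of Chasse's theorem on the Jensen polynomials of `ξ` (Chasse 2013,
Thm. 1.8; Farmer 2022 §4), assembled in
`Literature/Barriers/RiemannHypothesis/JensenPolynomialsChasse.lean`.

## Proof (all proved here)

* Hadamard's theorem in genus zero with multiplicities (the tree's
  `Literature.Analysis.Complex.hadamard_genus_zero_zeros`): `F(z)/F(0) = ∏ₙ (1 - bₙ z)`,
  `Σ‖bₙ‖ < ∞`, the non-zero `bₙ` being the inverse zeros, each zero `a` occurring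
  `analyticOrderNatAt F a` times.
* REAL approximants (the one new point compared with the real-zero case
  `PolyaSchur.splits_jensenPoly_taylor_of_zeros_real`): for a real `F` the zero orders are
  conjugation-symmetric (`analyticOrderNatAt_conj`), so the multiset of the `bₙ` with `|1/bₙ| ≤ k`
  is conjugation-invariant and the partial product over it is a REAL polynomial
  (`exists_real_lift_of_map_conj_eq`, via `Polynomial.lifts`), with zeros among the zeros of `F`.
* These partial products converge locally uniformly (`Summable.hasProdLocallyUniformlyOn_one_add`,
  along the finset filter), hence so do their Taylor coefficients; Obreschkoff's corollary
  (`splits_jensenPoly_taylorSeq_of_roots_mem_sector`) makes their `J^{d,0}` hyperbolic for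
  `d δ² ≤ 1`, and real-rootedness passes to the limit (`PolyaSchur.splits_of_tendsto_coeff`).

## References

* [KimLee2021] Y.-O. Kim, J. Lee, *A note on the zeros of Jensen polynomials*, arXiv:2105.05386,
  Thm. 3, Corollary and the Remark following the proof of Thm. 1 (pp. 1–2).
* [Conway1978] J. B. Conway, *Functions of One Complex Variable I*, Ch. XI Thm. 3.4 (Hadamard).
* [CravenCsordas1989] T. Craven, G. Csordas, Pacific J. Math. 136 (1989), §1 (i) (the real-zero
  case, Laguerre–Pólya class).
-/

noncomputable section

open Polynomial Finset Filter Metric Set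
open _root_.Complex _root_.Topology
open scoped ComplexConjugate Nat

namespace Literature.Analysis.Complex.Obreschkoff

open Literature.Analysis.Complex.PolyaSchur Literature.Analysis.TotalPositivity
  Literature.Analysis.Complex.HadamardGenusZero

/-! ### Conjugation symmetry of the zero orders of a real entire function -/

/-- For a real entire function (`F(z̄) = conj F(z)`) not vanishing at `0`, the order of vanishing
at `ā` equals that at `a`. [folklore] -/
theorem analyticOrderNatAt_conj {F : ℂ → ℂ} (hF : Differentiable ℂ F) (h0 : F 0 ≠ 0)
    (hreal : ∀ z, F (conj z) = conj (F z)) (a : ℂ) :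
    analyticOrderNatAt F (conj a) = analyticOrderNatAt F a := by
  have hFa : AnalyticAt ℂ F a := hF.analyticAt a
  obtain ⟨g, hg, hg0, hev⟩ := hFa.analyticOrderAt_ne_top.1 (analyticOrderAt_ne_top hF h0 a)
  have hconj : Tendsto (conj : ℂ → ℂ) (𝓝 (conj a)) (𝓝 a) := by
    simpa using (continuous_conj.tendsto (conj a))
  refine ((hF.analyticAt _).analyticOrderNatAt_eq_iff (analyticOrderAt_ne_top hF h0 _)).2
    ⟨conj ∘ g ∘ conj, ?_, by simpa using hg0, ?_⟩
  · rw [analyticAt_iff_eventually_differentiableAt]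
    have h1 : ∀ᶠ w in 𝓝 a, DifferentiableAt ℂ g w :=
      hg.eventually_analyticAt.mono fun w hw => hw.differentiableAt
    filter_upwards [hconj.eventually h1] with w hw
    simpa using hw.conj_conj
  · filter_upwards [hconj.eventually hev] with w hw
    calc F w = conj (F (conj w)) := by rw [hreal, conj_conj]
      _ = (w - conj a) ^ analyticOrderNatAt F a • (conj ∘ g ∘ conj) w := by
          rw [hw]
          simp only [smul_eq_mul, map_mul, map_pow, map_sub, conj_conj, Function.comp_apply]

/-! ### Real polynomials from conjugation-invariant root data -/

/-- If a finite multiset `s ⊂ ℂ` is invariant under conjugation, the polynomial `∏_{β ∈ s} (1 - βX)`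
has real coefficients: it is the image of a real polynomial. [folklore] -/
theorem exists_real_lift_of_map_conj_eq (s : Multiset ℂ) (hs : s.map conj = s) :
    ∃ p : ℝ[X], p.map (algebraMap ℝ ℂ) = (s.map fun β => (1 - C β * X : ℂ[X])).prod := by
  set q := (s.map fun β => (1 - C β * X : ℂ[X])).prod with hq
  have hconj : q.map (starRingEnd ℂ) = q := by
    rw [hq, Polynomial.map_multiset_prod, Multiset.map_map]
    conv_rhs => rw [← hs, Multiset.map_map]
    congr 1
    refine Multiset.map_congr rfl fun β _ => ?_
    simp [Polynomial.map_sub, Polynomial.map_mul]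
  have hcoef : ∀ k, q.coeff k ∈ Set.range (algebraMap ℝ ℂ) := fun k => by
    have h := congrArg (fun r : ℂ[X] => r.coeff k) hconj
    simp only [coeff_map] at h
    obtain ⟨r, hr⟩ := conj_eq_iff_real.1 h
    exact ⟨r, by rw [hr]; rfl⟩
  exact (mem_lifts q).1 ((lifts_iff_coeff_lifts q).2 hcoef)

/-- Locally uniform convergence is preserved by composition with a map of index filters.
[folklore] -/
theorem tendstoLocallyUniformlyOn_comp_of_tendsto {ι κ α β : Type*} [TopologicalSpace α]
    [UniformSpace β] {F : ι → α → β} {f : α → β} {p : Filter ι} {q : Filter κ} {s : Set α}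
    (h : TendstoLocallyUniformlyOn F f p s) {g : κ → ι} (hg : Tendsto g q p) :
    TendstoLocallyUniformlyOn (F ∘ g) f q s := fun u hu x hx =>
  let ⟨t, ht, hev⟩ := h u hu x hx
  ⟨t, ht, hg.eventually hev⟩

/-! ### The theorem -/

/-- **Jensen polynomials of a real entire function of order `< 1` with zeros in a sector.** If `F`
is entire with `‖F z‖ ≤ C exp(‖z‖^ρ)`, `ρ < 1`, real (`F(z̄) = conj F(z)`), `F 0 ≠ 0`, and every zero
of `F` lies in `S(δ) = {|Im z| ≤ δ|z|}`, then for `d δ² ≤ 1` the Jensen polynomial `J^{d,0}` of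
`(Re F⁽ᵏ⁾(0))_k` has only real zeros. (Kim–Lee's remark "`Z(f) ⊂ 𝕊(T)` ⟹ `J(f;d)` hyperbolic",
in the sector form their proof actually uses, for genus zero.)
[cite: KimLee2021, Remark after Theorem 3 (p. 2)] -/
theorem splits_jensenPoly_taylor_of_zeros_mem_sector {F : ℂ → ℂ} (hF : IsEntireOfOrderLtOne F)
    (hreal : ∀ z, F (conj z) = conj (F z)) (h0 : F 0 ≠ 0) {δ : ℝ}
    (hzero : ∀ z : ℂ, F z = 0 → z ∈ sector δ) {d : ℕ} (hd : (d : ℝ) * δ ^ 2 ≤ 1) :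
    (Literature.NumberTheory.LFunctions.jensenPoly (fun k => (iteratedDeriv k F 0).re) d 0).Splits := by
  classical
  obtain ⟨hdiff, ρ, C₀, hρ, hbound⟩ := hF
  obtain ⟨b, hb, hbzero, hbmult, hprod⟩ := hadamard_genus_zero_zeros F ρ C₀ hdiff hρ hbound h0
  -- `F 0` is real
  have hF0 : (((F 0).re : ℝ) : ℂ) = F 0 := by
    have h := hreal 0
    rw [map_zero] at h
    exact conj_eq_iff_re.1 h.symm
  have hc0 : (F 0).re ≠ 0 := fun h => h0 (by rw [← hF0, h, ofReal_zero])
  -- finiteness of the sets of large `bₙ`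
  have hfin : ∀ ε : ℝ, 0 < ε → {n : ℕ | ε ≤ ‖b n‖}.Finite := fun ε hε => by
    have hev := hb.tendsto_cofinite_zero.eventually (gt_mem_nhds hε)
    refine (Filter.eventually_cofinite.1 hev).subset fun n hn => ?_
    simp only [mem_setOf_eq, not_lt] at hn ⊢
    simpa using hn
  -- conjugation symmetry of the multiplicities of the values of `b`
  have hsymm : ∀ v : ℂ, v ≠ 0 → {n | b n = v}.ncard = {n | b n = conj v}.ncard := fun v hv => by
    have h1 := hbmult v⁻¹ (inv_ne_zero hv)
    have h2 := hbmult (conj v)⁻¹ (inv_ne_zero ((_root_.map_ne_zero _).2 hv))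
    rw [inv_inv] at h1 h2
    rw [h1, h2, ← map_inv₀, analyticOrderNatAt_conj hdiff h0 hreal]
  -- the index sets `I k = {n < k : bₙ = 0} ∪ {n : bₙ ≠ 0, |1/bₙ| ≤ k}`
  have hSfin : ∀ k : ℕ, {n : ℕ | b n ≠ 0 ∧ ‖b n‖⁻¹ ≤ k}.Finite := fun k => by
    refine (hfin ((k : ℝ) + 1)⁻¹ (by positivity)).subset fun n hn => ?_
    obtain ⟨h1, h2⟩ := hn
    have hpos : 0 < ‖b n‖ := norm_pos_iff.2 h1
    exact inv_le_of_inv_le₀ hpos (h2.trans (by linarith))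
  set I : ℕ → Finset ℕ := fun k => (range k).filter (fun n => b n = 0) ∪ (hSfin k).toFinset with hI
  have hmemI : ∀ k n, n ∈ I k ↔ (n < k ∧ b n = 0) ∨ (b n ≠ 0 ∧ ‖b n‖⁻¹ ≤ k) := fun k n => by
    simp [hI, Set.Finite.mem_toFinset]
  have hImono : Monotone I := fun k k' hkk' n hn => by
    rw [hmemI] at hn ⊢
    rcases hn with ⟨h1, h2⟩ | ⟨h1, h2⟩
    · exact Or.inl ⟨lt_of_lt_of_le h1 hkk', h2⟩
    · exact Or.inr ⟨h1, h2.trans (by exact_mod_cast hkk')⟩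
  have hIcov : ∀ n, ∃ k, n ∈ I k := fun n => by
    by_cases hn : b n = 0
    · exact ⟨n + 1, (hmemI _ _).2 (Or.inl ⟨n.lt_succ_self, hn⟩)⟩
    · exact ⟨⌈‖b n‖⁻¹⌉₊, (hmemI _ _).2 (Or.inr ⟨hn, Nat.le_ceil _⟩)⟩
  have hItend : Tendsto I atTop atTop := tendsto_atTop_finset_of_monotone hImono hIcov
  -- value counts on `I k`
  have hcount : ∀ (k : ℕ) (v : ℂ), v ≠ 0 →
      #((I k).filter fun n => v = b n) = if ‖v‖⁻¹ ≤ k then {n | b n = v}.ncard else 0 := by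
    intro k v hv
    have hvfin : {n | b n = v}.Finite :=
      (hfin ‖v‖ (norm_pos_iff.2 hv)).subset fun n hn => by
        simp only [mem_setOf_eq] at hn ⊢; rw [hn]
    split_ifs with hk
    · rw [Set.ncard_eq_toFinset_card _ hvfin]
      congr 1
      ext n
      simp only [mem_filter, hmemI, Set.Finite.mem_toFinset, mem_setOf_eq]
      constructor
      · rintro ⟨-, h⟩; exact h.symm
      · intro h; exact ⟨Or.inr ⟨by rw [h]; exact hv, by rw [h]; exact hk⟩, h.symm⟩
    · rw [card_eq_zero, filter_eq_empty_iff]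
      intro n hn h
      rw [hmemI] at hn
      rcases hn with ⟨-, h2⟩ | ⟨-, h2⟩
      · exact hv (by rw [h, h2])
      · exact hk (by rw [h]; exact h2)
  -- conjugation invariance of the multisets `b(I k)`
  have hIconj : ∀ k, ((I k).val.map b).map conj = (I k).val.map b := fun k => by
    ext w
    rw [show w = conj (conj w) from (conj_conj w).symm,
      Multiset.count_map_eq_count' _ _ (RingHom.injective _), conj_conj, Multiset.count_map,
      Multiset.count_map]
    change #((I k).filter fun n => conj w = b n) = #((I k).filter fun n => w = b n)
    by_cases hw : w = 0
    · simp [hw]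
    · rw [hcount k w hw, hcount k (conj w) ((_root_.map_ne_zero _).2 hw), norm_conj, ← hsymm w hw]
  -- the real approximants
  have hlift : ∀ k, ∃ p : ℝ[X], p.map (algebraMap ℝ ℂ) =
      (((I k).val.map b).map fun β => (1 - C β * X : ℂ[X])).prod :=
    fun k => exists_real_lift_of_map_conj_eq _ (hIconj k)
  choose p hp using hlift
  have hpeval : ∀ k (z : ℂ), ((p k).map (algebraMap ℝ ℂ)).eval z = ∏ n ∈ I k, (1 - b n * z) := by
    intro k z
    rw [hp, Multiset.map_map, eval_multiset_prod, Multiset.map_map, Finset.prod_eq_multiset_prod]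
    congr 1
    refine Multiset.map_congr rfl fun n _ => ?_
    simp
  -- their zeros lie in the sector
  have hproots : ∀ k (z : ℂ), aeval z (p k) = 0 → z ∈ sector δ := by
    intro k z hz
    rw [← eval_map_algebraMap, hpeval, Finset.prod_eq_zero_iff] at hz
    obtain ⟨n, -, hn⟩ := hz
    have hbn : b n ≠ 0 := by
      rintro h; rw [h, zero_mul, sub_zero] at hn; exact one_ne_zero hn
    have hz' : z = (b n)⁻¹ := by
      have h1 : b n * z = 1 := (sub_eq_zero.1 hn).symm
      exact (eq_inv_of_mul_eq_one_right h1)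
    rw [hz']
    exact hzero _ (hbzero n hbn)
  -- hence their Jensen polynomials are hyperbolic (Obreschkoff)
  have hsplit : ∀ k, (Literature.NumberTheory.LFunctions.jensenPoly (taylorSeq (p k)) d 0).Splits :=
    fun k => splits_jensenPoly_taylorSeq_of_roots_mem_sector (hproots k) hd
  -- locally uniform convergence of the partial products on the unit ball
  set G : ℕ → ℂ → ℂ := fun k z => ∏ n ∈ I k, (1 - b n * z) with hG
  have hloc : TendstoLocallyUniformlyOn G (fun z => F z / F 0) atTop (ball (0 : ℂ) 1) := by
    have h := Summable.hasProdLocallyUniformlyOn_one_add (f := fun n (z : ℂ) => -(b n * z))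
      (K := ball (0 : ℂ) 1) isOpen_ball hb (Eventually.of_forall fun n z hz => ?_)
      (fun n => (continuous_const.mul continuous_id).neg.continuousOn)
    · have h' : TendstoLocallyUniformlyOn (fun (s : Finset ℕ) (z : ℂ) => ∏ n ∈ s, (1 - b n * z))
          (fun z => F z / F 0) atTop (ball (0 : ℂ) 1) := by
        refine (h.congr fun s z _ => ?_).congr_right fun z _ => ?_
        · exact Finset.prod_congr rfl fun n _ => by ring
        · have h1 : HasProd (fun n => 1 + -(b n * z)) (F z / F 0) :=
            (hprod z).congr_fun fun n => by ring
          exact h1.tprod_eq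
      exact tendstoLocallyUniformlyOn_comp_of_tendsto h' hItend
    · rw [norm_neg, norm_mul]
      rw [mem_ball_zero_iff] at hz
      exact mul_le_of_le_one_right (norm_nonneg _) hz.le
  -- Taylor coefficients converge
  have hGp : ∀ k, G k = fun z => ((p k).map (algebraMap ℝ ℂ)).eval z :=
    fun k => funext fun z => (hpeval k z).symm
  have hGd : ∀ k, Differentiable ℂ (G k) := fun k => by
    rw [hGp]; exact Polynomial.differentiable _
  have hcoef : ∀ m, Tendsto (fun k => (iteratedDeriv m (G k) 0).re) atTop
      (𝓝 ((iteratedDeriv m F 0).re / (F 0).re)) := fun m => by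
    have h1 := ((tendstoLocallyUniformlyOn_iteratedDeriv isOpen_ball hGd hloc m).tendsto_at
      (mem_ball_self one_pos))
    have h2 : iteratedDeriv m (fun z => F z / F 0) 0 = iteratedDeriv m F 0 / F 0 :=
      iteratedDeriv_div_const _ _
    rw [h2] at h1
    have h3 := (continuous_re.tendsto _).comp h1
    rwa [← hF0, div_ofReal_re] at h3
  have htaylor : ∀ k m, (iteratedDeriv m (G k) 0).re = taylorSeq (p k) m := fun k m => by
    rw [hGp k]
    have : (fun z => ((p k).map (algebraMap ℝ ℂ)).eval z) =
        fun z => ((p k).map Complex.ofRealHom).eval z := rfl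
    rw [this, iteratedDeriv_polynomial_eval_zero, coeff_map, taylorSeq]
    simp
  -- pass to the limit for the sequence `γₘ / F(0)`, then rescale
  have key : (Literature.NumberTheory.LFunctions.jensenPoly
      (fun m => (iteratedDeriv m F 0).re / (F 0).re) d 0).Splits := by
    refine splits_of_tendsto_coeff (l := atTop)
      (P := fun k => Literature.NumberTheory.LFunctions.jensenPoly (taylorSeq (p k)) d 0) (N := d)
      (fun k => natDegree_jensenPoly_le _ _ _) (natDegree_jensenPoly_le _ _ _) (fun j => ?_)
      (Eventually.of_forall hsplit)
    by_cases hj : j ≤ d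
    · simp only [coeff_jensenPoly, if_pos hj, zero_add, ← htaylor]
      exact (hcoef j).const_mul _
    · simp only [coeff_jensenPoly, if_neg hj]
      exact tendsto_const_nhds
  have hresc : (fun m => (iteratedDeriv m F 0).re) =
      fun m => (F 0).re * ((iteratedDeriv m F 0).re / (F 0).re) := by
    funext m; field_simp
  rw [hresc, jensenPoly_const_mul]
  exact key.C_mul _

end Literature.Analysis.Complex.Obreschkoff
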